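import Mathlib
import Summits.Schanuel.Schanuel.Theorems.AclSubsetLogFreeCore.Negative.LogFreeCoreObjects
import Literature.NumberTheory.Transcendental.ZilberThm15
import Literature.ModelTheory.Quasiminimal.PregeometryStructures

/-!
# Stub `stub_aclSubsetEcl_of_eac` (line `eac-extends-core-automorphisms`, crux stmt-Schanuel-0968)

Under exponential-algebraic closedness of `ℂ_exp` (EAC), every element of a finite
`∅`-definable subset of `(ℂ, +, ·, −, 0, 1, exp)` is exponentially algebraic:
`acl^{ℂ_exp}(∅) ⊆ ecl(∅)`.

This is the parameter-free case `b = ∅` of the dichotomy `S ⊆ ecl b ∨ ℂ ∖ S ⊆ ecl b` in the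
tree's proof of Bays–Kirby 2018 Thm 1.5 / Thm 11.6
(`GammaField.isQuasiminimal_of_ccp_of_extension`, step `hgen`): for `S` `∅`-definable and
`a, a' ∉ ecl ∅`, `a ∈ S ↔ a' ∈ S` by Karp's lemma (`realize_iff_of_isBackAndForth`) applied to
the back-and-forth system of Γ-isomorphisms over `K = span ℚ (ecl ∅)` between tuples generating
strong subspaces (`GammaField.isBackAndForth_gammaIso_of_extension`); the one-point extension
property comes from the hull dichotomy (`GammaField.IsGammaIso.exists_extension_of_ccp`) and
Bays–Kirby's Prop. 11.2 (`BaysKirby2018_prop_11_2_holds`) fed with generic strong Γ-closedness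
over `K`, which EAC gives over `ℂ`
(`GammaField.isGenericallyStronglyGammaClosedOver_complex_of_isExpAlgClosed`), exactly as in
`isQuasiminimal_of_isExpAlgClosed_holds`. A finite `S` cannot contain the co-countable
`ℂ ∖ ecl ∅` (`ecl ∅` is countable by `hasCountableClosureProperty_complex_holds`), so `S ⊆ ecl ∅`.

## References

* M. Bays, J. Kirby, *Pseudo-exponential maps, variants, and quasiminimality*, Algebra & Number
  Theory 12 (2018) 493–549: Thm 1.5, Prop. 11.2, Thm 11.6 (proof).
-/

noncomputable section

open FirstOrder FirstOrder.Language Set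
open Literature.ModelTheory.ExponentialFields
open Literature.NumberTheory.Transcendental
open Summit.Schanuel.Schanuel.Theorems.AclSubsetLogFreeCore.Negative

namespace Summit.Schanuel.Schanuel.Theorems.RigidCore

open GammaField Literature.ModelTheory.ExponentialFields.ExponentialRing in
/-- **Under EAC, `acl^{ℂ_exp}(∅) ⊆ ecl(∅)`**: if `ℂ_exp` is exponentially-algebraically closed,
then every element of a finite `∅`-definable subset of `(ℂ, +, ·, −, 0, 1, exp)` lies in Kirby's
exponential-algebraic closure `ecl ∅`. Proof: the case `b = ∅` of the dichotomy in Bays–Kirby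
2018, Thm 11.6 (proof) — all points outside the countable `ecl ∅` have the same type over `∅`
(Karp's lemma for the Γ-isomorphisms over `span ℚ (ecl ∅)`, the extension property from
Prop. 11.2 and generic strong Γ-closedness, which EAC supplies), so a finite `∅`-definable set
misses all of the uncountable `ℂ ∖ ecl ∅`. [cite: BaysKirby2018ANT, Thm 1.5, Thm 11.6 (proof)] -/
theorem stub_aclSubsetEcl_of_eac :
    IsExpAlgClosed ℂ → expAcl ⊆ ecl (∅ : Set ℂ) := by
  classical
  intro hEAC a ha
  obtain ⟨s, hsfin, hsdef, has⟩ := ha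
  by_contra haE
  -- the base `K = span ℚ (ecl ∅)`: countable, Γ-closed, proper; GSΓC over `K` from EAC
  have hccp : HasCountableClosureProperty ℂ := hasCountableClosureProperty_complex_holds
  set K : Submodule ℚ ℂ := Submodule.span ℚ (ecl (∅ : Set ℂ)) with hK
  have hKc : (K : Set ℂ).Countable := countable_span_ecl hccp countable_empty
  have hKΓ : IsGammaClosed K := isGammaClosed_span_ecl_of_countable hccp countable_empty
  haveI : Uncountable ℂ := not_countable_univ_iff.1 not_countable_complex
  have hKtop : K ≠ ⊤ := by
    intro htop
    apply not_countable_complex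
    have : ((⊤ : Submodule ℚ ℂ) : Set ℂ) = univ := rfl
    rw [← this, ← htop]
    exact hKc
  have hG : IsGenericallyStronglyGammaClosedOver K :=
    isGenericallyStronglyGammaClosedOver_complex_of_isExpAlgClosed hEAC hKΓ
  -- the one-point extension property over `K` (hull dichotomy + Prop. 11.2)
  have hext : ∀ {N : ℕ} {c c' : Fin N → ℂ}, IsGammaIso K c c' →
      IsStrong (K ⊔ Submodule.span ℚ (range c)) → IsStrong (K ⊔ Submodule.span ℚ (range c')) →
      ∀ d : ℂ, ∃ (k : ℕ) (e e' : Fin (k + 1) → ℂ), e 0 = d ∧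
        IsGammaIso K (Fin.append c e) (Fin.append c' e') ∧
        IsStrong (K ⊔ Submodule.span ℚ (range (Fin.append c e))) ∧
        IsStrong (K ⊔ Submodule.span ℚ (range (Fin.append c' e'))) :=
    fun hiso hs hs' d => hiso.exists_extension_of_ccp hccp hKc
      (fun hs₁ hs₁' h₁ hδ _ => BaysKirby2018_prop_11_2_holds Complex.isAlgClosed
        isSurjectiveOntoUnits_complex hKΓ hKtop hKc hG hs₁ hs₁' h₁ hδ) hs hs' d
  -- a defining formula for `s`
  obtain ⟨φ, hφ⟩ := Set.empty_definable_iff.1 hsdef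
  have hmem : ∀ x : ℂ, x ∈ s ↔ φ.Realize (fun _ : Fin 1 => x) := by
    intro x
    have := Set.ext_iff.1 hφ (fun _ : Fin 1 => x)
    simpa only [Set.mem_setOf_eq] using this
  -- all points outside `ecl ∅` agree on membership in `s`
  have hgen : ∀ ⦃x x' : ℂ⦄, x ∉ ecl (∅ : Set ℂ) → x' ∉ ecl (∅ : Set ℂ) → (x ∈ s ↔ x' ∈ s) := by
    intro x x' hx hx'
    have hxK : x ∉ K := by rwa [hK, mem_span_ecl_iff]
    have hx'K : x' ∉ K := by rwa [hK, mem_span_ecl_iff]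
    obtain ⟨hKx, hx1⟩ := hKΓ.isStrong.sup_span_singleton hKΓ le_rfl hxK
    obtain ⟨hKx', hx'1⟩ := hKΓ.isStrong.sup_span_singleton hKΓ le_rfl hx'K
    have h0 : K ⊔ Submodule.span ℚ (range (Fin.elim0 : Fin 0 → ℂ)) = K := by
      rw [range_eq_empty, Submodule.span_empty, sup_bot_eq]
    have htd : td (K ⊔ Submodule.span ℚ (range (Fin.elim0 : Fin 0 → ℂ)))
        (Submodule.span ℚ {x}) = 2 := by
      rw [h0]; exact td_span_singleton_eq_two hxK hx1
    have htd' : td (K ⊔ Submodule.span ℚ (range (Fin.elim0 : Fin 0 → ℂ)))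
        (Submodule.span ℚ {x'}) = 2 := by
      rw [h0]; exact td_span_singleton_eq_two hx'K hx'1
    have hstart : IsGammaIso K (Fin.snoc Fin.elim0 x : Fin (0 + 1) → ℂ)
        (Fin.snoc Fin.elim0 x') :=
      (IsGammaIso.refl K (Fin.elim0 : Fin 0 → ℂ)).snoc htd htd'
    have hsx :
        IsStrong (K ⊔ Submodule.span ℚ (range (Fin.snoc Fin.elim0 x : Fin (0 + 1) → ℂ))) := by
      rw [sup_span_range_snoc, h0]; exact hKx
    have hsx' :
        IsStrong (K ⊔ Submodule.span ℚ (range (Fin.snoc Fin.elim0 x' : Fin (0 + 1) → ℂ))) := by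
      rw [sup_span_range_snoc, h0]; exact hKx'
    have hBF := isBackAndForth_gammaIso_of_extension hext (fun _ : Fin 1 => x)
      (fun _ : Fin 1 => x')
    have hcov : ∀ i : Fin 1, ∃ j,
        (Fin.snoc Fin.elim0 x : Fin (0 + 1) → ℂ) j = (fun _ : Fin 1 => x) i ∧
        (Fin.snoc Fin.elim0 x' : Fin (0 + 1) → ℂ) j = (fun _ : Fin 1 => x') i := fun _ =>
      ⟨Fin.last 0, by simp only [Fin.snoc_last], by simp only [Fin.snoc_last]⟩
    have key := realize_iff_of_isBackAndForth hBF φ (xs := default) (ys := default)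
      ⟨_, Fin.snoc Fin.elim0 x, Fin.snoc Fin.elim0 x', hstart, hsx, hsx', hcov, fun i => i.elim0⟩
    rw [Formula.boundedFormula_realize_eq_realize, Formula.boundedFormula_realize_eq_realize]
      at key
    rw [hmem x, hmem x']
    exact key
  -- a point outside the countable set `ecl ∅ ∪ s`
  have hC : (ecl (∅ : Set ℂ) ∪ s).Countable := (hccp ∅ countable_empty).union hsfin.countable
  obtain ⟨x', hx'⟩ : ∃ x', x' ∉ ecl (∅ : Set ℂ) ∪ s := by
    by_contra! hall
    exact not_countable_complex (hC.mono fun x _ => hall x)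
  exact (fun h => hx' (Or.inr h)) ((hgen haE fun h => hx' (Or.inl h)).1 has)

end Summit.Schanuel.Schanuel.Theorems.RigidCore

end
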